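import Literature.IUT.HodgeArakelov.ThetaSettingModelTateProfiniteInnerAut
import Literature.IUT.HodgeArakelov.ThetaSettingModelTateExoticDatum
import Literature.IUT.HodgeArakelov.EtaleThetaDataOfSettingInversion
import Literature.AnabelianGeometry.EtaleTheta.SettingModelTateDoubleUnderline
import HarnessLib

/-!
# The extension property `hextΔ` at the stage-2 Tate model: EXPLICIT FAMILIES OF AUTOMORPHISMS OF `Π^tp_{X̲̲}` THAT EXTEND —
# inner, normaliser-induced and profinite-inner (EXOTIC, NON-inner) ones (proof-only; K-L6 row «HEXT-DECIDE@modelχq», (K1))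

S. Mochizuki, *The étale theta function and its Frobenioid-theoretic manifestations* [EtTh], Publ. RIMS **45** (2009)
(refereed), §2, Prop. 2.4 p. 38: every automorphism of `Π^tp_{X̲̲}` extends to (indeed arises from) one of `Π^tp_X`
[cite: MochizukiEtTh2009, Prop 2.4 p.38]; §1 p. 12 (`Π^tp_X`, `Δ^tp_X`); Def. 2.5 (i) p. 39 (`X̲̲`); S. Mochizuki,
*Inter-universal Teichmüller theory II*, §1, Rmk. 1.4.1 (ii) (kurims p. 28) [claim: Mochizuki2012, status: disputed];
[SemiAnbd] Lem. 6.1 (i) p. 69 («`N_{F̂}(F) = F`») [cite: MochizukiSemiAnbd2006, Lem 6.1(i) p.69].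

Cell `abc-iut`, seat abc-iut-w5-d169 (gen 11; K-L6 row «HEXT-DECIDE@modelχq», abc-iut-L6-lead §F v1.19du (B1) «GO (K1)»,
2026-08-27T04:08:01Z).  PROOF-ONLY companion: NO definition, NO instance, NO new named fact; everything consumed BY NAME.

THE BINDER.  Four landed K-L6 files (abc-iut-L6-t2 p490266 `ThetaSettingCor112ModelTateOfExtends`, abc-iut-L6-d6 p477049 /
abc-iut-w6-d051 p490639 `Sec2Cor218iAtModelTateOddParity`, abc-iut-L6-t2 p491246, this lineage's p492265
`ThetaEvaluationSettingAtModelTateOfExtends`) display, at an `X̲̲`-choice `C` over the stage-2 Tate model `modelχq p i j`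
(`Π^tp_X = Γ ⋊_{(κ_p^i, κ_p^j, χ)} G_{ℚ_p}` = `PiTpχq p i j`, `Δ^tp_X = Γ ⋊ 1`), the [EtTh] Prop. 2.4-shaped binder
  `hextΔ : ∀ γ : Π^tp_{X̲̲} ≃ₜ* Π^tp_{X̲̲}, ∃ Γ : Π^tp_X ≃ₜ* Π^tp_X, Γ|_{Π^tp_{X̲̲}} = γ ∧ Γ(Δ^tp_X) = Δ^tp_X`
(«every bi-continuous automorphism of `Π^tp_{X̲̲}` extends to a `Δ^tp_X`-stabilising bi-continuous automorphism of `Π^tp_X`»).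
The verdict of record (this lineage, gen 10, 2026-08-27T04:04:31Z; booked §F v1.19du (B)) is: `hextΔ` is UNDECIDED AT THE
MODEL.  THIS FILE is the positive-side KERNEL CERTIFICATE of that verdict — the clause `hextΔ(γ)` for EXPLICIT families of `γ`:

§1 `map_deltaTempχq_eq_of_forall_right_eq` / `map_deltaTempχq_eq_of_forall_eq_conj` — `Δ^tp_X`-stability of any `Γ` OVER
   `G_{ℚ_p}` (`(Γ x).right = x.right`) and of any INNER `Γ = Ad(g)`, `g ∈ Π^tp_X`.
§2 `hext_at_of_forall_coe_eq_conj` — NORMALISER FAMILY: every `γ` acting as `h ↦ g h g⁻¹` for some `g ∈ Π^tp_X` (necessarily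
   `g ∈ N_{Π^tp_X}(Π^tp_{X̲̲})`; in particular every INNER automorphism of `Π^tp_{X̲̲}`) extends (`Γ := Ad(g)`).
   `hext_at_symm` / `hext_at_trans` — the extendable `γ` form a SUBGROUP of `Aut(Π^tp_{X̲̲})` (so a refuter need only exhibit one
   non-extendable class modulo this subgroup).
§3 `hext_at_of_forall_coe_eq_of_toHat_eq` — PROFINITE-INNER FAMILY: for `A ∈ F̂₂` with `ĥ_l(A) = 1`, abc-iut-L6-d2's
   `φ = Ad(A)|_{Π^tp_X}` (p494839 `exists_profiniteInner`: `Π^tp_X` is NORMALISED by all of `F̂₂` in `Π_X` — the model's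
   non-genuine feature) stabilises `Π^tp_{X̲̲} = dUU l ⋊ G` (`map_Huuχq_of_toHat_eq`) and is over `G` (`right_eq_of_toHat_eq`),
   hence every `γ` acting as `φ` on `Π^tp_{X̲̲}` extends.
   **`exists_nonInner_extends`** — at every `X̲̲`-choice `C` with `C.Huu = Huuχq p i j l hl` (e.g. the choice of record
   `doubleUnderlineχqOfEtaRes`), there is a bi-continuous automorphism `γ` of `Π^tp_{X̲̲}` which is NOT induced by conjugation by
   ANY element of `Π^tp_X` (a fortiori not inner on `Π^tp_{X̲̲}`; abc-iut-L6-d2's `not_inner_of_toHat_eq` with the exotic datum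
   `exists_exoticDatum` p494727: `ê(A) ∉ ι(ℤ)`) and which nevertheless EXTENDS with `Δ^tp_X`-stability.
NET CONTENT (numbers, not adjectives): «non-inner» ≠ «non-extendable» at the model — the exotic automorphisms that REFUTE the
(R1) uniqueness binder `huniq` (abc-iut-L6-d2 p495619) and the (β1) inner-ness clause are NOT counterexamples to `hextΔ`; every
automorphism family constructed in the tree so far ((a) inner, (b) normaliser-induced, (c) profinite-inner) satisfies the
clause.  What a refutation of `hextΔ` needs is recorded in the verdict (a bi-continuous `γ` moving `inl Ker(ĥ_l|dUU l)`);
what a proof needs is a rigidity theorem for equivariant automorphisms of the open subgroup `dUU l ≤ Γ` — neither is claimed.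

HONEST LABEL. `modelχq` is a SEMI-SYNTHETIC model of the typed [EtTh] §1 interface (not the tempered `π₁` of a curve): binder-
satisfiability evidence for OUR model only; nothing of [EtTh] / [IUTchII] (claim key `Mochizuki2012`, DISPUTED, D-0012) is
asserted; no side is taken on [IUTchIII] Cor. 3.12; typed ≠ proved; instantiated ≠ endorsed; nothing here bears on whether abc
is proved or refuted. bears_on: LADDER-ABC:A2.L-K (K-L6 «HEXT-DECIDE@modelχq») → LADDER-FRONTIER F-A2 (M·L6) → rung 0.
-/

set_option autoImplicit false

noncomputable section

namespace Literature.AnabelianGeometry.EtaleTheta.SettingModel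

open Literature.AnabelianGeometry.SemiGraphs
open Literature.IUT.HodgeArakelov Literature.IUT.HodgeArakelov.EtaleThetaDataOfSetting
open Function
open _root_.Topology

variable (p : ℕ) [Fact p.Prime] (i j : ℤ)

/-! ## §1. `Δ^tp_X`-stability: automorphisms over `G_{ℚ_p}` and inner automorphisms -/

/-- **An automorphism of `Π^tp_X` OVER `G_{ℚ_p}` maps `Δ^tp_X` onto itself** (`Δ^tp_X = {x | x.right = 1}`).
[cite: MochizukiEtTh2009, §1 p.12] -/
theorem map_deltaTempχq_eq_of_forall_right_eq (Γ : PiTpχq p i j ≃ₜ* PiTpχq p i j)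
    (hΓ : ∀ x, (Γ x).right = x.right) :
    (curveχq p i j).DeltaTemp.map Γ.toMulEquiv.toMonoidHom = (curveχq p i j).DeltaTemp := by
  ext x
  constructor
  · rintro ⟨y, hy, rfl⟩
    rw [SetLike.mem_coe, mem_deltaTempχq_iff] at hy
    change Γ y ∈ (curveχq p i j).DeltaTemp
    rw [mem_deltaTempχq_iff, hΓ, hy]
  · intro hx
    refine ⟨Γ.symm x, ?_, Γ.apply_symm_apply x⟩
    rw [mem_deltaTempχq_iff] at hx
    rw [SetLike.mem_coe, mem_deltaTempχq_iff, ← hΓ, Γ.apply_symm_apply, hx]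

/-- **An INNER automorphism of `Π^tp_X` maps `Δ^tp_X` onto itself** (`Δ^tp_X = Ker(aug)` is normal): for any `Γ` acting as
`x ↦ g x g⁻¹`. [cite: MochizukiEtTh2009, §1 p.12] -/
theorem map_deltaTempχq_eq_of_forall_eq_conj (Γ : PiTpχq p i j ≃ₜ* PiTpχq p i j) (g : PiTpχq p i j)
    (hΓ : ∀ x, Γ x = g * x * g⁻¹) :
    (curveχq p i j).DeltaTemp.map Γ.toMulEquiv.toMonoidHom = (curveχq p i j).DeltaTemp := by
  have key : ∀ x, Γ x ∈ (curveχq p i j).DeltaTemp ↔ x ∈ (curveχq p i j).DeltaTemp := fun x => by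
    rw [mem_deltaTempχq_iff, mem_deltaTempχq_iff, hΓ, SemidirectProduct.mul_right, SemidirectProduct.mul_right,
      SemidirectProduct.inv_right, mul_inv_eq_one, mul_eq_left]
  ext x
  constructor
  · rintro ⟨y, hy, rfl⟩
    exact (key y).2 hy
  · intro hx
    exact ⟨Γ.symm x, (key _).1 (by simpa using hx), Γ.apply_symm_apply x⟩

/-! ## §2. The normaliser family: every `γ = Ad(g)|_{Π^tp_{X̲̲}}`, `g ∈ Π^tp_X`, extends; the extendable `γ` form a group -/

section Families

variable {p i j} {hj : Even j} {E : (ThetaSetting.modelχq p i j hj).EtaleThetaData} {l : ℕ} (C : E.DoubleUnderline l)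

/-- **NORMALISER / INNER FAMILY.** If a bi-continuous automorphism `γ` of `Π^tp_{X̲̲}` acts as conjugation by an element
`g ∈ Π^tp_X` (so `g` normalises `Π^tp_{X̲̲}`; e.g. `g ∈ Π^tp_{X̲̲}`, the inner case), then `γ` EXTENDS to a `Δ^tp_X`-stabilising
bi-continuous automorphism of `Π^tp_X` — namely `Ad(g)`: the clause `hextΔ(γ)` holds. [cite: MochizukiEtTh2009, Prop 2.4 p.38] -/
theorem hext_at_of_forall_coe_eq_conj (γ : ↥C.Huu ≃ₜ* ↥C.Huu) (g : PiTpχq p i j)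
    (hγ : ∀ h : C.Huu, ((γ h : C.Huu) : PiTpχq p i j) = g * (h : PiTpχq p i j) * g⁻¹) :
    ∃ Γ : PiTpχq p i j ≃ₜ* PiTpχq p i j,
      (∀ h : C.Huu, Γ (h : PiTpχq p i j) = ((γ h : C.Huu) : PiTpχq p i j)) ∧
        (curveχq p i j).DeltaTemp.map Γ.toMulEquiv.toMonoidHom = (curveχq p i j).DeltaTemp := by
  let Γ : PiTpχq p i j ≃ₜ* PiTpχq p i j :=
    { MulAut.conj g with
      continuous_toFun := (continuous_const.mul continuous_id).mul continuous_const
      continuous_invFun := (continuous_const.mul continuous_id).mul continuous_const }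
  have hΓ : ∀ x, Γ x = g * x * g⁻¹ := fun _ => rfl
  exact ⟨Γ, fun h => by rw [hΓ, hγ], map_deltaTempχq_eq_of_forall_eq_conj p i j Γ g hΓ⟩

/-- The clause `hextΔ(γ)` holds at `γ = 1`. [cite: MochizukiEtTh2009, Prop 2.4 p.38] -/
theorem hext_at_refl :
    ∃ Γ : PiTpχq p i j ≃ₜ* PiTpχq p i j,
      (∀ h : C.Huu, Γ (h : PiTpχq p i j) = ((ContinuousMulEquiv.refl (↥C.Huu) h : C.Huu) : PiTpχq p i j)) ∧
        (curveχq p i j).DeltaTemp.map Γ.toMulEquiv.toMonoidHom = (curveχq p i j).DeltaTemp :=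
  ⟨ContinuousMulEquiv.refl _, fun _ => rfl, by
    change (curveχq p i j).DeltaTemp.map (MonoidHom.id _) = _
    exact Subgroup.map_id _⟩

/-- **The extendable automorphisms are closed under INVERSION**: `hextΔ(γ) → hextΔ(γ⁻¹)` (restrict `Γ⁻¹`).
[cite: MochizukiEtTh2009, Prop 2.4 p.38] -/
theorem hext_at_symm (γ : ↥C.Huu ≃ₜ* ↥C.Huu)
    (hγ : ∃ Γ : PiTpχq p i j ≃ₜ* PiTpχq p i j,
      (∀ h : C.Huu, Γ (h : PiTpχq p i j) = ((γ h : C.Huu) : PiTpχq p i j)) ∧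
        (curveχq p i j).DeltaTemp.map Γ.toMulEquiv.toMonoidHom = (curveχq p i j).DeltaTemp) :
    ∃ Γ : PiTpχq p i j ≃ₜ* PiTpχq p i j,
      (∀ h : C.Huu, Γ (h : PiTpχq p i j) = ((γ.symm h : C.Huu) : PiTpχq p i j)) ∧
        (curveχq p i j).DeltaTemp.map Γ.toMulEquiv.toMonoidHom = (curveχq p i j).DeltaTemp := by
  obtain ⟨Γ, hΓ, hΔ⟩ := hγ
  refine ⟨Γ.symm, fun h => ?_, ?_⟩
  · apply Γ.injective
    rw [Γ.apply_symm_apply, hΓ, γ.apply_symm_apply]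
  · have h := congrArg (Subgroup.map Γ.symm.toMulEquiv.toMonoidHom) hΔ
    rw [Subgroup.map_map] at h
    have hid : Γ.symm.toMulEquiv.toMonoidHom.comp Γ.toMulEquiv.toMonoidHom = MonoidHom.id _ :=
      MonoidHom.ext fun x => Γ.symm_apply_apply x
    rw [hid, Subgroup.map_id] at h
    exact h.symm

/-- **The extendable automorphisms are closed under COMPOSITION**: `hextΔ(γ₁) → hextΔ(γ₂) → hextΔ(γ₂ ∘ γ₁)` (compose the
extensions). [cite: MochizukiEtTh2009, Prop 2.4 p.38] -/
theorem hext_at_trans (γ₁ γ₂ : ↥C.Huu ≃ₜ* ↥C.Huu)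
    (h₁ : ∃ Γ : PiTpχq p i j ≃ₜ* PiTpχq p i j,
      (∀ h : C.Huu, Γ (h : PiTpχq p i j) = ((γ₁ h : C.Huu) : PiTpχq p i j)) ∧
        (curveχq p i j).DeltaTemp.map Γ.toMulEquiv.toMonoidHom = (curveχq p i j).DeltaTemp)
    (h₂ : ∃ Γ : PiTpχq p i j ≃ₜ* PiTpχq p i j,
      (∀ h : C.Huu, Γ (h : PiTpχq p i j) = ((γ₂ h : C.Huu) : PiTpχq p i j)) ∧
        (curveχq p i j).DeltaTemp.map Γ.toMulEquiv.toMonoidHom = (curveχq p i j).DeltaTemp) :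
    ∃ Γ : PiTpχq p i j ≃ₜ* PiTpχq p i j,
      (∀ h : C.Huu, Γ (h : PiTpχq p i j) = ((γ₁.trans γ₂ h : C.Huu) : PiTpχq p i j)) ∧
        (curveχq p i j).DeltaTemp.map Γ.toMulEquiv.toMonoidHom = (curveχq p i j).DeltaTemp := by
  obtain ⟨Γ₁, hΓ₁, hΔ₁⟩ := h₁
  obtain ⟨Γ₂, hΓ₂, hΔ₂⟩ := h₂
  refine ⟨Γ₁.trans Γ₂, fun h => ?_, ?_⟩
  · rw [ContinuousMulEquiv.trans_apply, hΓ₁, hΓ₂, ContinuousMulEquiv.trans_apply]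
  · change (curveχq p i j).DeltaTemp.map (Γ₂.toMulEquiv.toMonoidHom.comp Γ₁.toMulEquiv.toMonoidHom) = _
    rw [← Subgroup.map_map, hΔ₁, hΔ₂]

/-! ## §3. The profinite-inner family `Ad(A)|`, `A ∈ F̂₂`, `ĥ_l(A) = 1`: EXOTIC (non-inner) automorphisms that extend -/

/-- **PROFINITE-INNER FAMILY.** Let `A ∈ F̂₂` with `ĥ_l(A) = 1` and let `φ` be abc-iut-L6-d2's `Ad(A)|_{Π^tp_X}`
(`toHat (φ x) = inl A · toHat x · (inl A)⁻¹`, p494839).  At any `X̲̲`-choice `C` with `Π^tp_{X̲̲} = dUU l ⋊ G_{ℚ_p}`, every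
bi-continuous automorphism `γ` of `Π^tp_{X̲̲}` acting as `φ` EXTENDS with `Δ^tp_X`-stability (`Γ := φ`, over `G_{ℚ_p}` by
`right_eq_of_toHat_eq`): the clause `hextΔ(γ)` holds. [cite: MochizukiSemiAnbd2006, Lem 6.1(i) p.69] -/
theorem hext_at_of_forall_coe_eq_of_toHat_eq {A : F₂hatT} {φ : PiTpχq p i j ≃ₜ* PiTpχq p i j}
    (hφ : ∀ x, toHatχq p i j (φ x) = SemidirectProduct.inl A * toHatχq p i j x * (SemidirectProduct.inl A)⁻¹)
    (γ : ↥C.Huu ≃ₜ* ↥C.Huu) (hγ : ∀ h : C.Huu, ((γ h : C.Huu) : PiTpχq p i j) = φ (h : PiTpχq p i j)) :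
    ∃ Γ : PiTpχq p i j ≃ₜ* PiTpχq p i j,
      (∀ h : C.Huu, Γ (h : PiTpχq p i j) = ((γ h : C.Huu) : PiTpχq p i j)) ∧
        (curveχq p i j).DeltaTemp.map Γ.toMulEquiv.toMonoidHom = (curveχq p i j).DeltaTemp :=
  ⟨φ, fun h => (hγ h).symm, map_deltaTempχq_eq_of_forall_right_eq p i j φ (right_eq_of_toHat_eq hφ)⟩

/-- **NON-INNER ≠ NON-EXTENDABLE at the stage-2 Tate model.** At every `X̲̲`-choice `C` over `modelχq p i j` with
`Π^tp_{X̲̲} = dUU l ⋊ G_{ℚ_p}` (`l` odd; e.g. the choice of record `doubleUnderlineχqOfEtaRes`) there is a bi-continuous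
automorphism `γ` of `Π^tp_{X̲̲}` such that (1) `γ` is NOT induced by conjugation by ANY element of `Π^tp_X` (abc-iut-L6-d2's
`not_inner_of_toHat_eq` at the exotic datum `A := (η a^l)^v`, `ĥ_l(A) = 1`, `ê(A) = v^l ∉ ι(ℤ)`, p494727), (2) a fortiori `γ` is
NOT an inner automorphism of `Π^tp_{X̲̲}`, and yet (3) `γ` EXTENDS to a `Δ^tp_X`-stabilising bi-continuous automorphism of `Π^tp_X`
(`Ad(A)|_{Π^tp_X}`): the clause `hextΔ(γ)` HOLDS.  So the exotic automorphisms refuting `huniq` (p495619) / inner-ness clauses are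
no counterexamples to `hextΔ`. [cite: MochizukiSemiAnbd2006, Lem 6.1(i) p.69] -/
theorem exists_nonInner_extends (l' : ℕ+) (hl' : Odd (l' : ℕ)) (hCH : C.Huu = Huuχq p i j l' hl') :
    ∃ γ : ↥C.Huu ≃ₜ* ↥C.Huu,
      (¬ ∃ e : PiTpχq p i j, ∀ h : C.Huu, ((γ h : C.Huu) : PiTpχq p i j) = e * (h : PiTpχq p i j) * e⁻¹) ∧
      (¬ ∃ e : C.Huu, ∀ h : C.Huu, γ h = e * h * e⁻¹) ∧
        ∃ Γ : PiTpχq p i j ≃ₜ* PiTpχq p i j,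
          (∀ h : C.Huu, Γ (h : PiTpχq p i j) = ((γ h : C.Huu) : PiTpχq p i j)) ∧
            (curveχq p i j).DeltaTemp.map Γ.toMulEquiv.toMonoidHom = (curveχq p i j).DeltaTemp := by
  obtain ⟨A, hA, -, hA'⟩ := exists_exoticDatum l'
  obtain ⟨φ, hφ⟩ := exists_profiniteInner p i j A
  have hφH : C.Huu.map φ.toMulEquiv.toMonoidHom = C.Huu := by
    rw [hCH]
    exact map_Huuχq_of_toHat_eq hφ l' hl' hA
  -- the witness: the restriction of `φ = Ad(A)|_{Π^tp_X}` to `Π^tp_{X̲̲}`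
  let γ : ↥C.Huu ≃ₜ* ↥C.Huu := inversionAlpha C φ hφH
  have hγ : ∀ h : C.Huu, ((γ h : C.Huu) : PiTpχq p i j) = φ (h : PiTpχq p i j) := fun _ => rfl
  have h1 : ¬ ∃ e : PiTpχq p i j, ∀ h : C.Huu, ((γ h : C.Huu) : PiTpχq p i j) = e * (h : PiTpχq p i j) * e⁻¹ := by
    rintro ⟨e, he⟩
    refine not_inner_of_toHat_eq p i j hφ l' hl' hA' e fun h hh => ?_
    rw [← hCH] at hh
    rw [← hγ ⟨h, hh⟩]
    exact he ⟨h, hh⟩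
  refine ⟨γ, h1, ?_, hext_at_of_forall_coe_eq_of_toHat_eq C hφ γ hγ⟩
  rintro ⟨e, he⟩
  exact h1 ⟨(e : PiTpχq p i j), fun h => by rw [he]; rfl⟩

end Families

end Literature.AnabelianGeometry.EtaleTheta.SettingModel

end
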